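import Mathlib
import Literature.Analysis.FluidPDE.LerayHopfH1Test
import Literature.Analysis.FluidPDE.WholeSpaceIBP
import Summits.NavierStokesRegularity.NavierStokesRegularity.Theorems.CertifiedBlowupCertifiedBlowupAxisymBlowupEnergyDrain
import Summits.NavierStokesRegularity.NavierStokesRegularity.Theorems.RootDecompLitSliceMeanFieldTrilinear
import HarnessLib

/-!
# Mean-field lever, one-step toolkit III: the pairing identity on the tame classical frame

Helper file for the crux `RootDecompLitSlice.CritTameScarIsCritical` (Uᶜ, stmt-…-31733), continuing
`RootDecompLitSliceMeanFieldTrilinear` / `…TimeSide` / `…SliceCurrency`. The mean-field estimate of the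
energy drop `D(t) = ∫‖u t‖² − ∫‖u T‖²` writes `D(t) = ‖u t − u T‖₂² + 2⟨u t − u T, u T − w⟩ + 2⟨u t − u T, w⟩`
for a fixed comparison field `w` (a classical slice `u s₀`), and the last pairing is read off the
Navier–Stokes equations TESTED AGAINST THE FIXED `H¹_σ` FIELD `w` — the blueprint's step B1. That step is
the accepted Literature identity `IsLerayHopfOn.inner_weakGrad_test_eq` (Galdi 2000, Lemma 2.1: the weak
formulation against time-independent `H¹_σ` tests, valid up to and including the final time `T`), so no
limit `t₂ → T⁻` (blueprint B2) is needed.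

## Contents

* §1 `exists_measurable_gradient`, `lintegral_gradient_lt_top`: for a classical solution on `[0, T) × ℝ³`
  that is Leray–Hopf on `[0, T]`, the classical gradient `∇u(t)` has a jointly strongly measurable version
  on `(0, T)` (`exists_stronglyMeasurable_weakGradient`), a.e.-in-time a.e. equal to `fderiv ℝ (u t)`, hence
  a weak gradient of `u t` for a.e. `t`, with `∫₀ᵀ∫|∇u|²_F < ∞` (`EnergyDrain.dissipation_le_energy_sub`).
* §2 `inner_sub_inner_eq_integral_flux` — **the pairing identity**: for `w ∈ C¹ ∩ L²`, `div w = 0`,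
  `∫|∇w|²_F < ∞` and `t ∈ (0, T)`,
  `⟨u T, w⟩ − ⟨u t, w⟩ = ∫_{(t,T)} ( ∫⟪(u s·∇)w, u s⟫ − ν Σᵢ ∫⟪∂ᵢu s, ∂ᵢw⟫ ) ds`,
  with the classical gradient in the viscous flux; `integrableOn_flux`: the flux is integrable on `(0, T)`.
* §3 slice bounds for the two fluxes in the `ℝ≥0∞` currency of the dissipation clock:
  `enorm_sum_integral_inner_fderiv_le` (`‖Σᵢ∫⟪∂ᵢv, ∂ᵢw⟫‖ₑ ≤ (∫⁻|∇v|²_F)^{1/2} (∫⁻|∇w|²_F)^{1/2}`) and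
  `enorm_integral_inner_convect_right_le` (`div v = 0 ⟹ ∫⟪(v·∇)w, w⟫ = 0`, so
  `‖∫⟪(v·∇)w, v⟫‖ₑ ≤ ‖v − w‖₃ ‖∇w‖₂ ‖v‖₆` by Hölder `3·2·6` — the mean-field form of the convective term:
  it is small when the slice `v` is `L³`-close to the comparison field `w`).

All statements are over accepted `Literature.Analysis.FluidPDE` declarations and Mathlib; no new
definitions. [cite: Galdi2000, Lemma 2.1; ConstantinFoias1988, Ch. 6, Ch. 8]
-/

set_option linter.dupNamespace false

namespace Summit.NavierStokesRegularity.NavierStokesRegularity.Theorems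

open MeasureTheory Set Filter Topology Function Module
open scoped ENNReal NNReal RealInnerProductSpace
open Literature.Analysis.FluidPDE

namespace MeanFieldPairing

variable {ν T : ℝ} {u : ℝ → EuclideanSpace ℝ (Fin 3) → EuclideanSpace ℝ (Fin 3)}
  {p : ℝ → EuclideanSpace ℝ (Fin 3) → ℝ}

/-! ## §1 A measurable version of the classical gradient -/

/-- `dim ℝ³ = 3`. [folklore] -/
theorem finrank_eq_three : finrank ℝ (EuclideanSpace ℝ (Fin 3)) = 3 := by simp

/-- For a classical solution on `[0, T) × ℝ³`, Leray–Hopf on `[0, T]`, the classical gradient has a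
jointly strongly measurable version `G` on `(0, T)`: `G t = ∇u(t)` a.e. for a.e. `t`, and `G t` is a weak
gradient of `u t` for a.e. `t` (`exists_stronglyMeasurable_weakGradient`, `HasWeakGradient.of_contDiff`,
`HasWeakGradient.congr_grad_ae`). [folklore] -/
theorem exists_measurable_gradient (hcl : IsClassicalNSSolutionOn (Ico 0 T) ν 0 u p)
    (hLH : IsLerayHopfOn T ν 0 (u 0) u) :
    ∃ G : ℝ → EuclideanSpace ℝ (Fin 3) → EuclideanSpace ℝ (Fin 3) →L[ℝ] EuclideanSpace ℝ (Fin 3),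
      StronglyMeasurable (uncurry G) ∧
      (∀ᵐ t ∂(volume.restrict (Ioo 0 T)), G t =ᵐ[volume] fderiv ℝ (u t)) ∧
      (∀ᵐ t ∂(volume.restrict (Ioo 0 T)), HasWeakGradient (u t) (G t)) := by
  have hslice : ∀ t ∈ Ioo 0 T, HasWeakGradient (u t) (fderiv ℝ (u t)) := fun t ht =>
    HasWeakGradient.of_contDiff_holds
      ((hcl.smooth_velocity.contDiff_slice (Ioo_subset_Ico_self ht)).of_le (by norm_cast))
  have hae : ∀ᵐ t ∂(volume.restrict (Ioo 0 T)), HasWeakGradient (u t) (fderiv ℝ (u t)) :=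
    (ae_restrict_iff' measurableSet_Ioo).2 (Filter.Eventually.of_forall hslice)
  obtain ⟨G, hGm, hGae⟩ := exists_stronglyMeasurable_weakGradient hLH.weak.1 hae
  refine ⟨G, hGm, hGae, ?_⟩
  filter_upwards [hae, hGae] with t ht hG
  exact ht.congr_grad_ae hG

/-- The measurable version has finite space-time dissipation `∫₀ᵀ∫|G|²_F < ∞` (it agrees a.e. with the
classical gradient, whose dissipation is paid by the energy drop, `EnergyDrain.dissipation_le_energy_sub`).
[folklore] -/
theorem lintegral_gradient_lt_top (hν : 0 < ν) (hT : 0 < T)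
    (hcl : IsClassicalNSSolutionOn (Ico 0 T) ν 0 u p) (hLH : IsLerayHopfOn T ν 0 (u 0) u)
    {G : ℝ → EuclideanSpace ℝ (Fin 3) → EuclideanSpace ℝ (Fin 3) →L[ℝ] EuclideanSpace ℝ (Fin 3)}
    (hG : ∀ᵐ t ∂(volume.restrict (Ioo 0 T)), G t =ᵐ[volume] fderiv ℝ (u t)) :
    ∫⁻ t in Ioo 0 T, ∫⁻ x, ENNReal.ofReal (frobeniusNormSq (G t x)) < ⊤ := by
  have hfin := (CertifiedBlowupAxisymBlowup.EnergyDrain.dissipation_le_energy_sub hν hcl hLH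
    le_rfl hT.le le_rfl).1
  have heq : ∫⁻ t in Ioo 0 T, ∫⁻ x, ENNReal.ofReal (frobeniusNormSq (G t x)) =
      ∫⁻ t in Ioo 0 T, ∫⁻ x, ENNReal.ofReal (frobeniusNormSq (fderiv ℝ (u t) x)) := by
    refine lintegral_congr_ae ?_
    filter_upwards [hG] with t ht
    refine lintegral_congr_ae ?_
    filter_upwards [ht] with x hx
    rw [hx]
  rw [heq]; exact lt_top_iff_ne_top.2 hfin

/-! ## §2 The pairing identity -/

/-- **The pairing identity (Navier–Stokes tested against a fixed `H¹_σ` field, classical frame).** For a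
classical solution on `[0, T) × ℝ³`, `ν > 0`, Leray–Hopf on `[0, T]` from `u 0`, a fixed field
`w ∈ C¹ ∩ L²` with `div w = 0` and `∫|∇w|²_F < ∞`, and `t ∈ (0, T)`:
`⟨u T, w⟩ − ⟨u t, w⟩ = ∫_{(t,T)} ( ∫⟪(u s·∇)w, u s⟫ − ν Σᵢ ∫⟪∂ᵢ u s, ∂ᵢ w⟫ ) ds`
(Galdi 2000, Lemma 2.1 at the times `T` and `t`, subtracted; the measurable gradient version of §1 is
replaced by the classical gradient for a.e. `s`). Valid AT the final time `T`. [cite: Galdi2000, Lemma 2.1] -/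
theorem inner_sub_inner_eq_integral_flux (hν : 0 < ν) (hT : 0 < T)
    (hcl : IsClassicalNSSolutionOn (Ico 0 T) ν 0 u p) (hLH : IsLerayHopfOn T ν 0 (u 0) u)
    {w : EuclideanSpace ℝ (Fin 3) → EuclideanSpace ℝ (Fin 3)} (hw : ContDiff ℝ 1 w)
    (hw2 : MemLp w 2 volume) (hwdiv : VectorCalculus.IsDivFree w)
    (hwD : ∫⁻ x, ENNReal.ofReal (frobeniusNormSq (fderiv ℝ w x)) < ⊤) {t : ℝ} (ht : t ∈ Ioo 0 T) :
    (∫ x, ⟪u T x, w x⟫) - ∫ x, ⟪u t x, w x⟫ =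
      ∫ s in Ioo t T, ((∫ x, ⟪convect (u s) w x, u s x⟫) -
        ν * ∑ i, ∫ x, ⟪fderiv ℝ (u s) x (stdOrthonormalBasis ℝ _ i),
          fderiv ℝ w x (stdOrthonormalBasis ℝ _ i)⟫) := by
  set b := stdOrthonormalBasis ℝ (EuclideanSpace ℝ (Fin 3)) with hb
  obtain ⟨G, hGm, hGae, hGw⟩ := exists_measurable_gradient hcl hLH
  have hG2 := lintegral_gradient_lt_top hν hT hcl hLH hGae
  have hu₀ : MemLp (u 0) 2 volume := hLH.memLp 0 ⟨le_rfl, hT.le⟩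
  have hwwdiv : IsWeaklyDivFree w := VectorCalculus.IsDivFree.isWeaklyDivFree_holds hwdiv hw
  have hwG : HasWeakGradient w (fderiv ℝ w) := HasWeakGradient.of_contDiff_holds hw
  -- the flux with the measurable gradient version
  set F : ℝ → ℝ := fun s => (∫ x, ⟪fderiv ℝ w x (u s x), u s x⟫) -
    ν * ∑ i, ∫ x, ⟪G s x (b i), fderiv ℝ w x (b i)⟫ with hF
  have hId : ∀ t' ∈ Ioc 0 T, ∫ x, ⟪u t' x, w x⟫ = (∫ x, ⟪u 0 x, w x⟫) + ∫ s in Ioc 0 t', F s :=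
    fun t' ht' => hLH.inner_weakGrad_test_eq finrank_eq_three hu₀ hT hGm hGw hG2 hw2 hwwdiv hwG
      hwD ht'
  have hAD : AEStronglyMeasurable (fderiv ℝ w) volume :=
    (hw.continuous_fderiv one_ne_zero).aestronglyMeasurable
  have hFint : IntegrableOn F (Ioo 0 T) :=
    hLH.integrableOn_weakFlux finrank_eq_three hGm hGw hG2 hAD hwD
  have hFint' : IntegrableOn F (Ioc 0 T) := (integrableOn_Ioc_iff_integrableOn_Ioo (by simp)).2 hFint
  have hTT := hId T ⟨hT, le_rfl⟩
  have htt := hId t ⟨ht.1, ht.2.le⟩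
  -- `∫_{(0,T]} F - ∫_{(0,t]} F = ∫_{(t,T]} F`
  have hsplit : (∫ s in Ioc 0 T, F s) - ∫ s in Ioc 0 t, F s = ∫ s in Ioc t T, F s := by
    rw [← intervalIntegral.integral_of_le hT.le, ← intervalIntegral.integral_of_le ht.1.le,
      ← intervalIntegral.integral_of_le ht.2.le]
    refine intervalIntegral.integral_interval_sub_left ?_ ?_
    · exact (intervalIntegrable_iff_integrableOn_Ioc_of_le hT.le).2 hFint'
    · exact (intervalIntegrable_iff_integrableOn_Ioc_of_le ht.1.le).2
        (hFint'.mono_set (Ioc_subset_Ioc_right ht.2.le))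
  have hdiff : (∫ x, ⟪u T x, w x⟫) - ∫ x, ⟪u t x, w x⟫ = ∫ s in Ioc t T, F s := by
    rw [hTT, htt, ← hsplit]; ring
  rw [hdiff, setIntegral_congr_set (Ioo_ae_eq_Ioc (a := t) (b := T)).symm]
  -- replace the measurable version by the classical gradient for a.e. `s ∈ (t, T)`
  refine integral_congr_ae ?_
  have hsub : ∀ᵐ s ∂(volume.restrict (Ioo t T)), G s =ᵐ[volume] fderiv ℝ (u s) :=
    ae_restrict_of_ae_restrict_of_subset (Ioo_subset_Ioo ht.1.le le_rfl) hGae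
  filter_upwards [hsub] with s hs
  simp only [hF]
  congr 2
  refine Finset.sum_congr rfl fun i _ => integral_congr_ae ?_
  filter_upwards [hs] with x hx
  rw [hx]

/-- The flux of the pairing identity (classical gradient) is integrable on `(0, T)`
(`IsLerayHopfOn.integrableOn_weakFlux` for the measurable version, a.e. equal). [folklore] -/
theorem integrableOn_flux (hν : 0 < ν) (hT : 0 < T)
    (hcl : IsClassicalNSSolutionOn (Ico 0 T) ν 0 u p) (hLH : IsLerayHopfOn T ν 0 (u 0) u)
    {w : EuclideanSpace ℝ (Fin 3) → EuclideanSpace ℝ (Fin 3)} (hw : ContDiff ℝ 1 w)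
    (hwD : ∫⁻ x, ENNReal.ofReal (frobeniusNormSq (fderiv ℝ w x)) < ⊤) :
    IntegrableOn (fun s => (∫ x, ⟪convect (u s) w x, u s x⟫) -
        ν * ∑ i, ∫ x, ⟪fderiv ℝ (u s) x (stdOrthonormalBasis ℝ _ i),
          fderiv ℝ w x (stdOrthonormalBasis ℝ _ i)⟫) (Ioo 0 T) := by
  set b := stdOrthonormalBasis ℝ (EuclideanSpace ℝ (Fin 3)) with hb
  obtain ⟨G, hGm, hGae, hGw⟩ := exists_measurable_gradient hcl hLH
  have hG2 := lintegral_gradient_lt_top hν hT hcl hLH hGae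
  have hAD : AEStronglyMeasurable (fderiv ℝ w) volume :=
    (hw.continuous_fderiv one_ne_zero).aestronglyMeasurable
  have hFint := hLH.integrableOn_weakFlux finrank_eq_three hGm hGw hG2 hAD hwD
  refine hFint.congr_fun_ae ?_
  filter_upwards [hGae] with s hs
  show ((∫ x, ⟪fderiv ℝ w x (u s x), u s x⟫) - ν * ∑ i, ∫ x, ⟪G s x (b i), fderiv ℝ w x (b i)⟫) =
    (∫ x, ⟪convect (u s) w x, u s x⟫) - ν * ∑ i, ∫ x, ⟪fderiv ℝ (u s) x (b i), fderiv ℝ w x (b i)⟫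
  congr 2
  refine Finset.sum_congr rfl fun i _ => integral_congr_ae ?_
  filter_upwards [hs] with x hx
  rw [hx]

/-! ## §3 Slice bounds for the two fluxes, `ℝ≥0∞` currency -/

section Slice

variable {E : Type*} [NormedAddCommGroup E] [InnerProductSpace ℝ E] [FiniteDimensional ℝ E]
  [MeasurableSpace E] [BorelSpace E]

/-- `ofReal (√x) = (ofReal x) ^ (1/2)`. [folklore] -/
theorem ofReal_sqrt_eq_rpow_half (x : ℝ) :
    ENNReal.ofReal (Real.sqrt x) = ENNReal.ofReal x ^ (1 / 2 : ℝ) := by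
  rcases le_or_gt x 0 with hx | hx
  · rw [Real.sqrt_eq_zero'.2 hx, ENNReal.ofReal_of_nonpos hx, ENNReal.ofReal_zero,
      ENNReal.zero_rpow_of_pos (by norm_num)]
  · rw [Real.sqrt_eq_rpow, ENNReal.ofReal_rpow_of_pos hx]

/-- **Viscous flux, slice bound (`ℝ≥0∞`).** For fields `v w` with integrable gradient energy
densities, `‖Σᵢ ∫ ⟪Dv eᵢ, Dw eᵢ⟫‖ₑ ≤ (∫⁻ |Dv|²_F)^{1/2} (∫⁻ |Dw|²_F)^{1/2}` (Cauchy–Schwarz in the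
frame and in `L²`; Constantin–Foias 1988, Ch. 6). [folklore] -/
theorem enorm_sum_integral_inner_fderiv_le {v w : E → E}
    (hv : Integrable (fun x => frobeniusNormSq (fderiv ℝ v x)))
    (hw : Integrable (fun x => frobeniusNormSq (fderiv ℝ w x)))
    (hi : ∀ i, Integrable (fun x => ⟪fderiv ℝ v x (stdOrthonormalBasis ℝ E i),
      fderiv ℝ w x (stdOrthonormalBasis ℝ E i)⟫)) :
    ‖∑ i, ∫ x, ⟪fderiv ℝ v x (stdOrthonormalBasis ℝ E i), fderiv ℝ w x (stdOrthonormalBasis ℝ E i)⟫‖ₑ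
      ≤ (∫⁻ x, ENNReal.ofReal (frobeniusNormSq (fderiv ℝ v x))) ^ (1 / 2 : ℝ) *
        (∫⁻ x, ENNReal.ofReal (frobeniusNormSq (fderiv ℝ w x))) ^ (1 / 2 : ℝ) := by
  rw [← integral_finsetSum _ fun i _ => hi i]
  have h := MeanFieldTrilinear.abs_integral_sum_inner_fderiv_le hv hw
  rw [Real.enorm_eq_ofReal_abs]
  refine (ENNReal.ofReal_le_ofReal h).trans ?_
  rw [ENNReal.ofReal_mul (Real.sqrt_nonneg _), ofReal_sqrt_eq_rpow_half, ofReal_sqrt_eq_rpow_half,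
    ofReal_integral_eq_lintegral_ofReal hv (Filter.Eventually.of_forall fun x =>
      frobeniusNormSq_nonneg _),
    ofReal_integral_eq_lintegral_ofReal hw (Filter.Eventually.of_forall fun x =>
      frobeniusNormSq_nonneg _)]

/-- **Convective flux, slice bound (`ℝ≥0∞`).** For `C¹` fields `v w` with `div v = 0`:
`∫ ⟪(v·∇)w, w⟫ = 0`, so `∫ ⟪(v·∇)w, v⟫ = ∫ ⟪(v·∇)w, v − w⟫` and by Hölder `3·2·6`
`‖∫ ⟪(v·∇)w, v⟫‖ₑ ≤ ‖v − w‖₃ ‖Dw‖₂ ‖v‖₆` (Constantin–Foias 1988, Ch. 6 and Ch. 8). [folklore] -/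
theorem enorm_integral_inner_convect_right_le {v w : E → E} (hv : ContDiff ℝ 1 v)
    (hw : ContDiff ℝ 1 w) (hdiv : VectorCalculus.IsDivFree v)
    (h0 : Integrable (fun x => ⟪w x, w x⟫ • v x))
    (h1 : Integrable (fun x => ⟪convect v w x, w x⟫))
    (h2 : Integrable (fun x => ⟪convect v w x, v x⟫))
    (h3 : MemLp (fun x => v x - w x) 3 volume) (hDw : MemLp (fderiv ℝ w) 2 volume)
    (h6 : MemLp v 6 volume) :
    ‖∫ x, ⟪convect v w x, v x⟫‖ₑ ≤
      eLpNorm (fun x => v x - w x) 3 volume * (eLpNorm (fderiv ℝ w) 2 volume * eLpNorm v 6 volume) := by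
  have hzero := MeanFieldTrilinear.integral_inner_convect_self_eq_zero_of_isDivFree hv hw hdiv h0 h1
  have heq : ∫ x, ⟪convect v w x, v x⟫ = ∫ x, ⟪convect v w x, v x - w x⟫ := by
    have : (fun x => ⟪convect v w x, v x - w x⟫) = fun x => ⟪convect v w x, v x⟫ - ⟪convect v w x, w x⟫ := by
      funext x; rw [inner_sub_right]
    rw [this, integral_sub h2 h1, hzero, sub_zero]
  have hH := MeanFieldTrilinear.integral_norm_mul_mul_le volume h3 hDw h6
  have hptw : ∀ x, ‖⟪convect v w x, v x - w x⟫‖ ≤ ‖v x - w x‖ * (‖fderiv ℝ w x‖ * ‖v x‖) := by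
    intro x
    rw [Real.norm_eq_abs, ← real_inner_comm]
    exact MeanFieldTrilinear.abs_inner_convect_le _ _
  have hle : ‖∫ x, ⟪convect v w x, v x - w x⟫‖ ≤
      (eLpNorm (fun x => v x - w x) 3 volume).toReal *
        ((eLpNorm (fderiv ℝ w) 2 volume).toReal * (eLpNorm v 6 volume).toReal) :=
    (norm_integral_le_of_norm_le hH.1 (Filter.Eventually.of_forall hptw)).trans hH.2
  rw [heq, ← ofReal_norm]
  refine (ENNReal.ofReal_le_ofReal hle).trans ?_
  rw [ENNReal.ofReal_mul ENNReal.toReal_nonneg, ENNReal.ofReal_mul ENNReal.toReal_nonneg,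
    ENNReal.ofReal_toReal h3.eLpNorm_ne_top, ENNReal.ofReal_toReal hDw.eLpNorm_ne_top,
    ENNReal.ofReal_toReal h6.eLpNorm_ne_top]

end Slice

end MeanFieldPairing
end Summit.NavierStokesRegularity.NavierStokesRegularity.Theorems
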